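import Mathlib
import Literature.Algebra.Polynomial.PolyaPositivstellensatz
import HarnessLib

/-!
# Motzkin–Straus and the de Klerk–Pasechnik LP hierarchy for the stability number

The quadratic-optimization side of the stable set problem, formalised verbatim from the
literature, with complete proofs and no new axioms:

* **Motzkin–Straus** [cite: MotzkinStraus1965, Thm 1] [cite: Gvozdenovic2008, Thm 4.2.8]
  [cite: LaurentVargas2022, (M-S)]: `1/α(G) = min {xᵀ(I + A_G)x : x ∈ Δ}`
  (`motzkinStraus`: `IsLeast`, from `inv_indepNum_le_msForm` and
  `exists_msForm_eq_inv_indepNum`), and the clique form `max {xᵀA_Gx : x ∈ Δ} = 1 - 1/ω(G)`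
  (`motzkinStraus_clique`; Motzkin–Straus write `∑_{ij ∈ E} xᵢxⱼ = ½ xᵀA_Gx`, whence their
  `½(1 - 1/ω)`). The lower bound is the support-reduction argument: along an edge inside the
  support the form `xᵀ(I + A_G)x` has zero curvature, so weight can be pushed to one endpoint;
  on an independent support Cauchy–Schwarz gives `≥ 1/|supp| ≥ 1/α`.
* **Copositive formulations** [cite: BomzeEtAl2000, §2] [cite: Gvozdenovic2008, Thm 4.2.7,
  Cor 4.2.9] [cite: DeklerkPasechnik2002, (2)] [cite: LaurentVargas2022, §1]:
  `Q - λJ ∈ COP_n ↔ λ ≤ min_Δ xᵀQx` (`isCopositive_sub_smul_ones_iff`) and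
  `t(I + A_G) - J ∈ COP_n ↔ α(G) ≤ t` (`isCopositive_dkpMatrix_iff`,
  `isLeast_isCopositive_dkpMatrix`: `α(G) = min {t : t(I + A_G) - J ∈ COP_n}`).
* **Parrilo's LP cones `C^{(r)}_n`** (`InPolyaCone r M`: `(∑ xᵢ)^r · xᵀMx` has nonnegative
  coefficients) [cite: LaurentVargas2022, §1] [cite: DeklerkPasechnik2002, §4]
  [cite: Gvozdenovic2008, §4.2.1]: monotone in `r` (`InPolyaCone.mono`), contained in `COP_n`
  (`InPolyaCone.isCopositive`), exhaust the strictly copositive matrices with the Powers–Reznick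
  rate `r > max|M_ij| / min_Δ xᵀMx - 2` (`inPolyaCone_of_strict`, via the in-tree
  `Literature.Algebra.Polynomial.polya_powersReznick`), and are cut out by the finitely many
  linear inequalities `mᵀMm ≥ mᵀdiag(M)` (`|m| = r + 2`) — the coefficient formula
  `(∏ mₖ!)·[x^m]((∑xᵢ)^r xᵀMx) = r!(mᵀMm - mᵀdiag M)` [cite: Gvozdenovic2008, (4.35)]
  (`prod_factorial_mul_coeff`, `inPolyaCone_iff`).
* **The LP hierarchy `ζ^{(r)}(G) = min {t : t(I + A_G) - J ∈ C^{(r)}_n}`**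
  [cite: DeklerkPasechnik2002, §4] [cite: LaurentVargas2022, §1] [cite: PenaVeraZuluaga2007, §3]:
  the LP conditions read `(r+2)(r+1) ≤ t · excess(m)` with
  `excess(m) = mᵀ(I + A_G)m - |m| ∈ ℕ` (`inPolyaCone_dkpMatrix_iff`); the program is feasible
  iff `α(G) ≤ r + 1` (`exists_inPolyaCone_dkpMatrix_iff`); every feasible `t` is `≥ α(G)`
  (`indepNum_le_of_inPolyaCone_dkpMatrix`) and `> α(G)` unless `G` is complete
  (`indepNum_lt_of_inPolyaCone_dkpMatrix`, the Peña–Vera–Zuluaga non-exactness); for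
  `r + 1 ≥ α(G)²` the value `t = α(r+1)/(r+2-α) < α + 1` is feasible
  (`exists_inPolyaCone_dkpMatrix_lt`), so `⌊ζ^{(r)}(G)⌋ = α(G)` (`floor_zeta_eq_indepNum`,
  with `zeta G r := sInf {feasible t}` attained by closedness, `inPolyaCone_dkpMatrix_zeta`) and
  `ζ^{(r)}(G) > α(G)` for non-complete `G` (`indepNum_lt_zeta`).

Conventions. `V` is a finite vertex type, `Δ = stdSimplex ℝ V`; `xᵀ(I + A_G)x` is
`msForm G x = x ⬝ᵥ (1 + A_G) *ᵥ x = ∑ xᵢ² + ∑_{(i,j) : i ~ j} xᵢxⱼ` (ordered pairs);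
`IsCopositive M` does not assume `M` symmetric (only the symmetric part matters); integer
vectors `m ∈ ℕⁿ` are `V →₀ ℕ` with `|m| = m.degree`. `zeta G r` carries the junk value
`sInf ∅ = 0` when `r + 1 < α(G)`; all statements about it assume feasibility. The original
de Klerk–Pasechnik paper is cited through the restatements we hold
([cite: LaurentVargas2022, §1], [cite: Gvozdenovic2008, §4.2]). Not treated here: the
semidefinite cones `K^{(r)}_n` / the parameters `ϑ^{(r)}(G)` and the de Klerk–Pasechnik
conjecture `ϑ^{(α-1)}(G) = α(G)`; the Lasserre moment hierarchy `las^{(t)}(G)` lives in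
`Literature.Combinatorics.SimpleGraph.LasserreStableBound` / `LasserreFiniteConvergence`.
Private lemmas marked `[folklore]` are routine algebra (bilinear expansions, indicator vectors,
casts).
-/

noncomputable section

open Finset Matrix

namespace Literature.Combinatorics.Optimization.MotzkinStrausCopositive

variable {V : Type*} [Fintype V]

/-! ## Quadratic forms `xᵀ M x` — bilinear bookkeeping -/

section Forms

variable (M : Matrix V V ℝ)

/-- `(a + b)ᵀ M (a + b)` expanded. [folklore] -/
@[folklore] private theorem form_add (a b : V → ℝ) :
    (a + b) ⬝ᵥ M *ᵥ (a + b) = a ⬝ᵥ M *ᵥ a + a ⬝ᵥ M *ᵥ b + b ⬝ᵥ M *ᵥ a + b ⬝ᵥ M *ᵥ b := by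
  simp only [Matrix.mulVec_add, dotProduct_add, add_dotProduct]; ring

/-- `(a - b)ᵀ M (a - b)` expanded. [folklore] -/
@[folklore] private theorem form_sub (a b : V → ℝ) :
    (a - b) ⬝ᵥ M *ᵥ (a - b) = a ⬝ᵥ M *ᵥ a - a ⬝ᵥ M *ᵥ b - b ⬝ᵥ M *ᵥ a + b ⬝ᵥ M *ᵥ b := by
  simp only [Matrix.mulVec_sub, dotProduct_sub, sub_dotProduct]; ring

/-- `(c • a)ᵀ M (c • a) = c² · aᵀ M a`. [folklore] -/
@[folklore] private theorem form_smul (c : ℝ) (a : V → ℝ) :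
    (c • a) ⬝ᵥ M *ᵥ (c • a) = c ^ 2 * (a ⬝ᵥ M *ᵥ a) := by
  simp only [Matrix.mulVec_smul, dotProduct_smul, smul_dotProduct, smul_eq_mul]; ring

/-- For a symmetric matrix the bilinear form is symmetric. [folklore] -/
@[folklore] private theorem form_comm (hM : Mᵀ = M) (a b : V → ℝ) :
    a ⬝ᵥ M *ᵥ b = b ⬝ᵥ M *ᵥ a := by
  rw [Matrix.dotProduct_mulVec, ← Matrix.mulVec_transpose, hM, dotProduct_comm]

/-- `eₐᵀ M e_b = M a b`. [folklore] -/
@[folklore] private theorem single_form_single [DecidableEq V] (a b : V) :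
    Pi.single a (1 : ℝ) ⬝ᵥ M *ᵥ Pi.single b 1 = M a b := by
  rw [Matrix.mulVec_single_one, single_dotProduct, one_mul]; rfl

/-- A quadratic form with a direction of zero curvature is affine along that direction:
if `(p - q)ᵀM(p - q) = 0` and `λ + μ = 1` then
`(λp + μq)ᵀM(λp + μq) = λ pᵀMp + μ qᵀMq`. [folklore] -/
@[folklore] private theorem form_affine_of_flat (hM : Mᵀ = M) (p q : V → ℝ) {lam mu : ℝ}
    (h1 : lam + mu = 1) (hflat : (p - q) ⬝ᵥ M *ᵥ (p - q) = 0) :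
    (lam • p + mu • q) ⬝ᵥ M *ᵥ (lam • p + mu • q) =
      lam * (p ⬝ᵥ M *ᵥ p) + mu * (q ⬝ᵥ M *ᵥ q) := by
  have hx : (lam • p + mu • q) ⬝ᵥ M *ᵥ (lam • p + mu • q) =
      lam ^ 2 * (p ⬝ᵥ M *ᵥ p) + 2 * (lam * mu) * (p ⬝ᵥ M *ᵥ q) + mu ^ 2 * (q ⬝ᵥ M *ᵥ q) := by
    rw [form_add, form_smul, form_smul, form_comm M hM (mu • q)]
    simp only [Matrix.mulVec_smul, dotProduct_smul, smul_dotProduct, smul_eq_mul]; ring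
  have hf : (p ⬝ᵥ M *ᵥ p) - 2 * (p ⬝ᵥ M *ᵥ q) + (q ⬝ᵥ M *ᵥ q) = 0 := by
    rw [form_sub, form_comm M hM q p] at hflat; linarith
  linear_combination hx - (lam * mu) * hf + (lam * (p ⬝ᵥ M *ᵥ p) + mu * (q ⬝ᵥ M *ᵥ q)) * h1

end Forms

/-! ## The Motzkin–Straus form `xᵀ(I + A_G)x` -/

variable [DecidableEq V] (G : SimpleGraph V) [DecidableRel G.Adj]

omit [Fintype V] in
/-- The Motzkin–Straus matrix `I + A_G` of a graph [cite: MotzkinStraus1965, Thm 1]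
[cite: Gvozdenovic2008, Thm 4.2.8]. -/
def msMatrix : Matrix V V ℝ := 1 + G.adjMatrix ℝ

/-- The Motzkin–Straus quadratic form `xᵀ (I + A_G) x` [cite: MotzkinStraus1965, Thm 1]
[cite: LaurentVargas2022, (M-S)]. -/
def msForm (x : V → ℝ) : ℝ := x ⬝ᵥ msMatrix G *ᵥ x

omit [Fintype V] in
/-- `I + A_G` is symmetric. [folklore] -/
@[folklore] private theorem msMatrix_transpose : (msMatrix G)ᵀ = msMatrix G := by
  simp [msMatrix, Matrix.transpose_add, SimpleGraph.transpose_adjMatrix]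

omit [Fintype V] in
/-- Entries of `I + A_G`. [folklore] -/
@[folklore] private theorem msMatrix_apply (i j : V) :
    msMatrix G i j = (if i = j then 1 else 0) + (if G.Adj i j then 1 else 0) := by
  simp [msMatrix, Matrix.add_apply, Matrix.one_apply, SimpleGraph.adjMatrix_apply]

/-- The form written out: `xᵀ(I + A_G)x = ∑ᵢ xᵢ² + ∑_{i ~ j} xᵢ xⱼ` (ordered adjacent pairs,
so every edge is counted twice) [cite: Gvozdenovic2008, Thm 4.2.8]
[cite: LaurentVargas2022, (M-S)]. -/
theorem msForm_eq_sum (x : V → ℝ) :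
    msForm G x = ∑ i, x i ^ 2 + ∑ i, ∑ j, if G.Adj i j then x i * x j else 0 := by
  simp only [msForm, dotProduct, Matrix.mulVec, msMatrix_apply, add_mul, ite_mul, one_mul,
    zero_mul, Finset.sum_add_distrib, Finset.sum_ite_eq, Finset.mem_univ, if_true, sq]
  simp only [mul_add, Finset.sum_add_distrib, Finset.mul_sum, mul_ite, mul_zero]

/-- Homogeneity: `(c x)ᵀ(I + A_G)(c x) = c² xᵀ(I + A_G)x`. [folklore] -/
@[folklore] private theorem msForm_smul (c : ℝ) (x : V → ℝ) :
    msForm G (c • x) = c ^ 2 * msForm G x := form_smul _ c x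

/-- Along an edge `ij` the form has zero curvature: `(eᵢ - eⱼ)ᵀ(I + A_G)(eᵢ - eⱼ) = 0`.
[folklore] -/
@[folklore] private theorem msForm_single_sub_single {i j : V} (h : G.Adj i j) :
    msForm G (Pi.single i 1 - Pi.single j 1) = 0 := by
  have hij : i ≠ j := G.ne_of_adj h
  rw [msForm, form_sub, single_form_single, single_form_single, single_form_single,
    single_form_single, msMatrix_apply, msMatrix_apply, msMatrix_apply, msMatrix_apply]
  simp [hij, hij.symm, h, h.symm]

/-- On a vector whose support is an independent set the adjacency part vanishes:
`xᵀ(I + A_G)x = ∑_{i ∈ supp x} xᵢ²`. [folklore] -/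
@[folklore] private theorem msForm_eq_sum_sq_of_indep (x : V → ℝ)
    (hind : G.IsIndepSet ↑(univ.filter fun i => x i ≠ 0)) :
    msForm G x = ∑ i ∈ univ.filter (fun i => x i ≠ 0), x i ^ 2 := by
  rw [msForm_eq_sum]
  have hadj : ∑ i, ∑ j, (if G.Adj i j then x i * x j else 0) = 0 := by
    refine Finset.sum_eq_zero fun i _ => Finset.sum_eq_zero fun j _ => ?_
    split_ifs with hij
    · by_contra hne
      have hi : x i ≠ 0 := fun h0 => hne (by rw [h0, zero_mul])
      have hj : x j ≠ 0 := fun h0 => hne (by rw [h0, mul_zero])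
      exact hind (by simpa using hi) (by simpa using hj) (G.ne_of_adj hij) hij
    · rfl
  rw [hadj, add_zero, Finset.sum_filter_of_ne]
  intro i _ hi
  exact fun h0 => hi (by rw [h0]; ring)

/-- Support reduction (the heart of the Motzkin–Straus argument): every point of the simplex
can be replaced by one whose support is an independent set without increasing
`xᵀ(I + A_G)x` — move the weight of one endpoint of an edge inside the support onto the
other endpoint; the form is affine along that segment. [folklore] -/
@[folklore] private theorem exists_indep_support_le (x : V → ℝ) (hx : x ∈ stdSimplex ℝ V) :
    ∃ y ∈ stdSimplex ℝ V, G.IsIndepSet ↑(univ.filter fun i => y i ≠ 0) ∧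
      msForm G y ≤ msForm G x := by
  suffices h : ∀ n, ∀ x : V → ℝ, x ∈ stdSimplex ℝ V → #(univ.filter fun i => x i ≠ 0) ≤ n →
      ∃ y ∈ stdSimplex ℝ V, G.IsIndepSet ↑(univ.filter fun i => y i ≠ 0) ∧
        msForm G y ≤ msForm G x from h _ x hx le_rfl
  intro n
  induction n with
  | zero =>
    intro x hx hcard
    exfalso
    have h0 : ∀ i, x i = 0 := fun i => by
      by_contra hi
      have : i ∈ univ.filter (fun i => x i ≠ 0) := by simpa using hi
      rw [Nat.le_zero, Finset.card_eq_zero] at hcard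
      rw [hcard] at this
      simp at this
    have h1 := hx.2
    simp [h0] at h1
  | succ n ih =>
    intro x hx hcard
    by_cases hind : G.IsIndepSet ↑(univ.filter fun i => x i ≠ 0)
    · exact ⟨x, hx, hind, le_rfl⟩
    -- an edge `ij` inside the support
    obtain ⟨i, hi, j, hj, hij, hadj⟩ : ∃ i, x i ≠ 0 ∧ ∃ j, x j ≠ 0 ∧ i ≠ j ∧ G.Adj i j := by
      by_contra hcon
      refine hind fun a ha b hb hab => ?_
      by_contra hadj'
      simp only [Finset.coe_filter, Finset.mem_univ, true_and, Set.mem_setOf_eq] at ha hb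
      exact hcon ⟨a, ha, b, hb, hab, hadj'⟩
    have hxi : 0 < x i := lt_of_le_of_ne (hx.1 i) (Ne.symm hi)
    have hxj : 0 < x j := lt_of_le_of_ne (hx.1 j) (Ne.symm hj)
    set s : ℝ := x i + x j with hs_def
    have hs : 0 < s := by positivity
    set d : V → ℝ := Pi.single i 1 - Pi.single j 1 with hd_def
    have hd_i : d i = 1 := by simp [hd_def, hij]
    have hd_j : d j = -1 := by simp [hd_def, hij.symm]
    have hd_k : ∀ k, k ≠ i → k ≠ j → d k = 0 := fun k hki hkj => by simp [hd_def, hki, hkj]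
    have hd_sum : ∑ k, d k = 0 := by
      simp [hd_def, Finset.sum_sub_distrib, Finset.sum_pi_single']
    -- the two endpoints of the segment
    set yp : V → ℝ := x + x j • d with hyp_def
    set ym : V → ℝ := x - x i • d with hym_def
    have hyp_mem : yp ∈ stdSimplex ℝ V := by
      refine ⟨fun k => ?_, ?_⟩
      · simp only [hyp_def, Pi.add_apply, Pi.smul_apply, smul_eq_mul]
        by_cases hki : k = i
        · subst hki; rw [hd_i]; linarith
        by_cases hkj : k = j
        · subst hkj; rw [hd_j]; linarith
        rw [hd_k k hki hkj, mul_zero, add_zero]; exact hx.1 k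
      · simp only [hyp_def, Pi.add_apply, Pi.smul_apply, smul_eq_mul, Finset.sum_add_distrib,
          ← Finset.mul_sum, hd_sum, mul_zero, add_zero]
        exact hx.2
    have hym_mem : ym ∈ stdSimplex ℝ V := by
      refine ⟨fun k => ?_, ?_⟩
      · simp only [hym_def, Pi.sub_apply, Pi.smul_apply, smul_eq_mul]
        by_cases hki : k = i
        · subst hki; rw [hd_i]; linarith
        by_cases hkj : k = j
        · subst hkj; rw [hd_j]; linarith
        rw [hd_k k hki hkj, mul_zero, sub_zero]; exact hx.1 k
      · simp only [hym_def, Pi.sub_apply, Pi.smul_apply, smul_eq_mul, Finset.sum_sub_distrib,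
          ← Finset.mul_sum, hd_sum, mul_zero, sub_zero]
        exact hx.2
    -- smaller supports: `j ∉ supp yp`, `i ∉ supp ym`, both inside `supp x`
    have hsub_p : (univ.filter fun k => yp k ≠ 0) ⊆ (univ.filter fun k => x k ≠ 0).erase j := by
      intro k hk
      simp only [Finset.mem_filter, Finset.mem_univ, true_and, Finset.mem_erase] at hk ⊢
      simp only [hyp_def, Pi.add_apply, Pi.smul_apply, smul_eq_mul] at hk
      by_cases hkj : k = j
      · subst hkj; rw [hd_j] at hk; exact absurd (by ring) hk
      refine ⟨hkj, ?_⟩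
      by_cases hki : k = i
      · subst hki; exact hi
      rw [hd_k k hki hkj, mul_zero, add_zero] at hk; exact hk
    have hsub_m : (univ.filter fun k => ym k ≠ 0) ⊆ (univ.filter fun k => x k ≠ 0).erase i := by
      intro k hk
      simp only [Finset.mem_filter, Finset.mem_univ, true_and, Finset.mem_erase] at hk ⊢
      simp only [hym_def, Pi.sub_apply, Pi.smul_apply, smul_eq_mul] at hk
      by_cases hki : k = i
      · subst hki; rw [hd_i] at hk; exact absurd (by ring) hk
      refine ⟨hki, ?_⟩
      by_cases hkj : k = j
      · subst hkj; exact hj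
      rw [hd_k k hki hkj, mul_zero, sub_zero] at hk; exact hk
    have hjmem : j ∈ univ.filter (fun k => x k ≠ 0) := by simpa using hj
    have himem : i ∈ univ.filter (fun k => x k ≠ 0) := by simpa using hi
    have hcard_p : #(univ.filter fun k => yp k ≠ 0) ≤ n := by
      have := Finset.card_le_card hsub_p
      rw [Finset.card_erase_of_mem hjmem] at this
      omega
    have hcard_m : #(univ.filter fun k => ym k ≠ 0) ≤ n := by
      have := Finset.card_le_card hsub_m
      rw [Finset.card_erase_of_mem himem] at this
      omega
    obtain ⟨zp, hzp, hzp_ind, hzp_le⟩ := ih yp hyp_mem hcard_p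
    obtain ⟨zm, hzm, hzm_ind, hzm_le⟩ := ih ym hym_mem hcard_m
    -- `x` is an affine combination of the endpoints and the form is affine on the segment
    have hcomb : x = (x i / s) • yp + (x j / s) • ym := by
      funext k
      simp only [hyp_def, hym_def, Pi.add_apply, Pi.smul_apply, Pi.sub_apply, smul_eq_mul]
      field_simp
      ring
    have hflat : (yp - ym) ⬝ᵥ msMatrix G *ᵥ (yp - ym) = 0 := by
      have hdiff : yp - ym = s • d := by
        funext k
        simp only [hyp_def, hym_def, Pi.add_apply, Pi.smul_apply, Pi.sub_apply, smul_eq_mul,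
          hs_def]
        ring
      rw [hdiff]
      have := msForm_single_sub_single G hadj
      rw [msForm, ← hd_def] at this
      rw [form_smul, this, mul_zero]
    have haff : msForm G x = x i / s * msForm G yp + x j / s * msForm G ym := by
      have h1 : x i / s + x j / s = 1 := by rw [← add_div, div_self (ne_of_gt hs)]
      conv_lhs => rw [hcomb]
      exact form_affine_of_flat (msMatrix G) (msMatrix_transpose G) yp ym h1 hflat
    have hli : 0 < x i / s := div_pos hxi hs
    have hlj : 0 < x j / s := div_pos hxj hs
    have h1 : x i / s + x j / s = 1 := by rw [← add_div, div_self (ne_of_gt hs)]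
    by_cases hle : msForm G yp ≤ msForm G ym
    · refine ⟨zp, hzp, hzp_ind, le_trans hzp_le ?_⟩
      calc msForm G yp = x i / s * msForm G yp + x j / s * msForm G yp := by
            rw [← add_mul, h1, one_mul]
        _ ≤ x i / s * msForm G yp + x j / s * msForm G ym := by
            have := mul_le_mul_of_nonneg_left hle hlj.le; linarith
        _ = msForm G x := haff.symm
    · refine ⟨zm, hzm, hzm_ind, le_trans hzm_le ?_⟩
      have hle' : msForm G ym ≤ msForm G yp := le_of_lt (lt_of_not_ge hle)
      calc msForm G ym = x i / s * msForm G ym + x j / s * msForm G ym := by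
            rw [← add_mul, h1, one_mul]
        _ ≤ x i / s * msForm G yp + x j / s * msForm G ym := by
            have := mul_le_mul_of_nonneg_left hle' hli.le; linarith
        _ = msForm G x := haff.symm

/-- **Motzkin–Straus, lower bound** [cite: MotzkinStraus1965, Thm 1]
[cite: Gvozdenovic2008, Thm 4.2.8] [cite: LaurentVargas2022, (M-S)]:
`xᵀ(I + A_G)x ≥ 1/α(G)` for every `x` in the standard simplex. -/
theorem inv_indepNum_le_msForm (x : V → ℝ) (hx : x ∈ stdSimplex ℝ V) :
    1 / (G.indepNum : ℝ) ≤ msForm G x := by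
  obtain ⟨y, hy, hind, hle⟩ := exists_indep_support_le G x hx
  refine le_trans ?_ hle
  set t := univ.filter (fun i => y i ≠ 0) with ht_def
  have ht : #t ≤ G.indepNum := hind.card_le_indepNum
  have h1 : msForm G y = ∑ i ∈ t, y i ^ 2 := msForm_eq_sum_sq_of_indep G y hind
  have h2 : ∑ i ∈ t, y i = 1 := by
    rw [ht_def, Finset.sum_filter_of_ne fun i _ h => h]; exact hy.2
  have ht0 : 0 < #t := by
    rw [Finset.card_pos]
    by_contra hne
    rw [Finset.not_nonempty_iff_eq_empty] at hne
    rw [hne, Finset.sum_empty] at h2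
    exact zero_ne_one h2
  have hCS := Finset.sum_mul_sq_le_sq_mul_sq t y (fun _ => (1 : ℝ))
  simp only [mul_one, h2, one_pow, Finset.sum_const, nsmul_eq_mul] at hCS
  have htpos : (0 : ℝ) < #t := by exact_mod_cast ht0
  calc 1 / (G.indepNum : ℝ) ≤ 1 / (#t : ℝ) :=
        one_div_le_one_div_of_le htpos (by exact_mod_cast ht)
    _ ≤ ∑ i ∈ t, y i ^ 2 := by rw [div_le_iff₀ htpos]; linarith
    _ = msForm G y := h1.symm

omit [DecidableEq V] [DecidableRel G.Adj] in
/-- A nonempty graph has an independent vertex, so `α(G) ≥ 1`. [folklore] -/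
@[folklore] private theorem indepNum_pos [Nonempty V] : 0 < G.indepNum := by
  classical
  obtain ⟨v⟩ := ‹Nonempty V›
  have h : G.IsIndepSet ↑({v} : Finset V) := by simp [SimpleGraph.isIndepSet_iff]
  have := h.card_le_indepNum
  simp at this
  omega

/-- The uniform distribution on a maximum independent set `S` lies in the simplex and gives
`xᵀ(I + A_G)x = |S| / |S|² = 1/α(G)`. [folklore] -/
@[folklore] private theorem uniform_mem_and_msForm_eq [Nonempty V] {S : Finset V}
    (hS : G.IsNIndepSet G.indepNum S) :
    (fun i => if i ∈ S then 1 / (G.indepNum : ℝ) else 0) ∈ stdSimplex ℝ V ∧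
      msForm G (fun i => if i ∈ S then 1 / (G.indepNum : ℝ) else 0) = 1 / (G.indepNum : ℝ) := by
  have hα : 0 < G.indepNum := indepNum_pos G
  have hαr : (0 : ℝ) < G.indepNum := by exact_mod_cast hα
  set x : V → ℝ := fun i => if i ∈ S then 1 / (G.indepNum : ℝ) else 0 with hx_def
  have hxS : ∀ i, x i ≠ 0 → i ∈ S := fun i hi => by
    by_contra h; exact hi (by simp [hx_def, h])
  refine ⟨⟨fun i => by simp only [hx_def]; split_ifs <;> positivity, ?_⟩, ?_⟩
  · rw [Finset.sum_ite_mem, Finset.univ_inter, Finset.sum_const, hS.card_eq, nsmul_eq_mul,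
      mul_one_div, div_self (ne_of_gt hαr)]
  · have hind : G.IsIndepSet ↑(univ.filter fun i => x i ≠ 0) := by
      intro a ha b hb hab
      simp only [Finset.coe_filter, Finset.mem_univ, true_and, Set.mem_setOf_eq] at ha hb
      exact hS.isIndepSet (by simpa using hxS a ha) (by simpa using hxS b hb) hab
    rw [msForm_eq_sum_sq_of_indep G x hind, Finset.sum_filter_of_ne (fun i _ h => by
      intro h0; exact h (by rw [h0]; ring))]
    simp only [hx_def]
    rw [show (∑ i, (if i ∈ S then 1 / (G.indepNum : ℝ) else 0) ^ 2) =
        ∑ i, if i ∈ S then (1 / (G.indepNum : ℝ)) ^ 2 else 0 from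
      Finset.sum_congr rfl fun i _ => by split_ifs <;> simp]
    rw [Finset.sum_ite_mem, Finset.univ_inter, Finset.sum_const, hS.card_eq, nsmul_eq_mul]
    field_simp

/-- **Motzkin–Straus, attainment** [cite: MotzkinStraus1965, Thm 1]
[cite: Gvozdenovic2008, Thm 4.2.8]: the uniform distribution on a maximum independent set
gives `xᵀ(I + A_G)x = 1/α(G)`. -/
theorem exists_msForm_eq_inv_indepNum [Nonempty V] :
    ∃ x ∈ stdSimplex ℝ V, msForm G x = 1 / (G.indepNum : ℝ) := by
  obtain ⟨S, hS⟩ := G.exists_isNIndepSet_indepNum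
  obtain ⟨hx, h⟩ := uniform_mem_and_msForm_eq G hS
  exact ⟨_, hx, h⟩

/-- **Motzkin–Straus theorem** (stable-set form) [cite: MotzkinStraus1965, Thm 1]
[cite: Gvozdenovic2008, Thm 4.2.8] [cite: LaurentVargas2022, (M-S)]:
`1/α(G) = min { xᵀ(I + A_G)x : x ∈ Δ }`. -/
theorem motzkinStraus [Nonempty V] :
    IsLeast (msForm G '' stdSimplex ℝ V) (1 / (G.indepNum : ℝ)) := by
  refine ⟨?_, ?_⟩
  · obtain ⟨x, hx, h⟩ := exists_msForm_eq_inv_indepNum G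
    exact ⟨x, hx, h⟩
  · rintro _ ⟨x, hx, rfl⟩
    exact inv_indepNum_le_msForm G x hx

/-! ### The clique form -/

/-- `xᵀ A_H x + xᵀ(I + A_{H̄})x = (∑ xᵢ)²`: every ordered pair `(i, j)` is a loop, an edge of `H`
or an edge of the complement. [folklore] -/
@[folklore] private theorem adjForm_add_msForm_compl (x : V → ℝ) :
    x ⬝ᵥ G.adjMatrix ℝ *ᵥ x + msForm Gᶜ x = (∑ i, x i) ^ 2 := by
  have hadj : x ⬝ᵥ G.adjMatrix ℝ *ᵥ x = ∑ i, ∑ j, if G.Adj i j then x i * x j else 0 := by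
    simp only [dotProduct, Matrix.mulVec, SimpleGraph.adjMatrix_apply, Finset.mul_sum, ite_mul,
      one_mul, zero_mul, mul_ite, mul_zero]
  have hsq : ∑ i, x i ^ 2 = ∑ i, ∑ j, if i = j then x i * x j else 0 := by
    simp only [Finset.sum_ite_eq, Finset.mem_univ, if_true, sq]
  rw [hadj, msForm_eq_sum, hsq, sq, Finset.sum_mul_sum, ← Finset.sum_add_distrib,
    ← Finset.sum_add_distrib]
  refine Finset.sum_congr rfl fun i _ => ?_
  rw [← Finset.sum_add_distrib, ← Finset.sum_add_distrib]
  refine Finset.sum_congr rfl fun j _ => ?_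
  simp only [SimpleGraph.compl_adj]
  by_cases hij : i = j
  · subst hij; simp
  · by_cases h : G.Adj i j
    · simp [hij, h]
    · simp [hij, h]

/-- **Motzkin–Straus theorem** (clique form) [cite: MotzkinStraus1965, Thm 1]:
`max { xᵀ A_G x : x ∈ Δ } = 1 - 1/ω(G)` (Motzkin–Straus sum over unordered edges, i.e.
`½ xᵀA_Gx`, and obtain `½ (1 - 1/ω(G))`). -/
theorem motzkinStraus_clique [Nonempty V] :
    IsGreatest ((fun x : V → ℝ => x ⬝ᵥ G.adjMatrix ℝ *ᵥ x) '' stdSimplex ℝ V)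
      (1 - 1 / (G.cliqueNum : ℝ)) := by
  have hval : ∀ x ∈ stdSimplex ℝ V, x ⬝ᵥ G.adjMatrix ℝ *ᵥ x = 1 - msForm Gᶜ x := by
    intro x hx
    have := adjForm_add_msForm_compl G x
    rw [hx.2, one_pow] at this
    linarith
  rw [← SimpleGraph.indepNum_compl]
  refine ⟨?_, ?_⟩
  · obtain ⟨x, hx, h⟩ := exists_msForm_eq_inv_indepNum Gᶜ
    exact ⟨x, hx, by simp only; rw [hval x hx, h]⟩
  · rintro _ ⟨x, hx, rfl⟩
    simp only
    rw [hval x hx]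
    linarith [inv_indepNum_le_msForm Gᶜ x hx]

/-! ## Copositive formulation of `α(G)` -/

omit [Fintype V] [DecidableEq V] in
/-- The all-ones matrix `J` [cite: Gvozdenovic2008, Thm 4.2.7] [cite: LaurentVargas2022, §1]. -/
def onesMatrix : Matrix V V ℝ := Matrix.of fun _ _ => 1

/-- A real matrix `M` is *copositive* when `xᵀ M x ≥ 0` for every entrywise nonnegative `x`
(the cone `COP_n` / `𝒞_n`) [cite: LaurentVargas2022, §1 (COP_n)] [cite: Gvozdenovic2008, §4.2]. -/
def IsCopositive (M : Matrix V V ℝ) : Prop :=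
  ∀ x : V → ℝ, (∀ i, 0 ≤ x i) → 0 ≤ x ⬝ᵥ M *ᵥ x

omit [DecidableEq V] in
/-- `xᵀ J x = (∑ xᵢ)²`. [folklore] -/
@[folklore] private theorem form_onesMatrix (x : V → ℝ) :
    x ⬝ᵥ onesMatrix *ᵥ x = (∑ i, x i) ^ 2 := by
  simp [onesMatrix, dotProduct, Matrix.mulVec, ← Finset.sum_mul, sq]

omit [DecidableEq V] in
/-- `xᵀ (Q - λJ) x = xᵀ Q x - λ (∑ xᵢ)²`. [folklore] -/
@[folklore] private theorem form_sub_smul_ones (Q : Matrix V V ℝ) (lam : ℝ) (x : V → ℝ) :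
    x ⬝ᵥ (Q - lam • onesMatrix) *ᵥ x = x ⬝ᵥ Q *ᵥ x - lam * (∑ i, x i) ^ 2 := by
  rw [Matrix.sub_mulVec, dotProduct_sub, Matrix.smul_mulVec, dotProduct_smul,
    form_onesMatrix, smul_eq_mul]

omit [DecidableEq V] in
/-- A nonnegative vector with coordinate sum `s > 0` is `s` times a point of the simplex.
[folklore] -/
@[folklore] private theorem inv_smul_mem_stdSimplex {x : V → ℝ} (hx : ∀ i, 0 ≤ x i)
    (hs : 0 < ∑ i, x i) : (∑ i, x i)⁻¹ • x ∈ stdSimplex ℝ V := by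
  constructor
  · intro i
    simp only [Pi.smul_apply, smul_eq_mul]
    exact mul_nonneg (inv_nonneg.2 hs.le) (hx i)
  · simp only [Pi.smul_apply, smul_eq_mul, ← Finset.mul_sum]
    exact inv_mul_cancel₀ (ne_of_gt hs)

omit [DecidableEq V] in
/-- A nonnegative vector with coordinate sum `0` is `0`. [folklore] -/
@[folklore] private theorem eq_zero_of_sum_eq_zero {x : V → ℝ} (hx : ∀ i, 0 ≤ x i)
    (hs : ∑ i, x i = 0) : x = 0 := by
  funext i
  exact (Finset.sum_eq_zero_iff_of_nonneg fun i _ => hx i).1 hs i (Finset.mem_univ i)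

omit [DecidableEq V] in
/-- **Standard quadratic optimization as a copositive program** (Bomze–Dür–de Klerk–Roos–
Quist–Terlaky) [cite: BomzeEtAl2000, §2] [cite: Gvozdenovic2008, Thm 4.2.7]:
`Q - λJ` is copositive iff `λ ≤ min_{x ∈ Δ} xᵀ Q x`; hence
`min_{x ∈ Δ} xᵀQx = max {λ : Q - λJ ∈ COP_n}`. -/
theorem isCopositive_sub_smul_ones_iff (Q : Matrix V V ℝ) (lam : ℝ) :
    IsCopositive (Q - lam • onesMatrix) ↔ ∀ x ∈ stdSimplex ℝ V, lam ≤ x ⬝ᵥ Q *ᵥ x := by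
  constructor
  · intro h x hx
    have := h x hx.1
    rw [form_sub_smul_ones, hx.2, one_pow, mul_one] at this
    linarith
  · intro h x hx
    rw [form_sub_smul_ones]
    rcases (Finset.sum_nonneg fun i (_ : i ∈ univ) => hx i).eq_or_lt with hs | hs
    · rw [eq_zero_of_sum_eq_zero hx hs.symm]; simp
    · have hu := h _ (inv_smul_mem_stdSimplex hx hs)
      rw [form_smul] at hu
      have h2 := mul_le_mul_of_nonneg_left hu (sq_nonneg (∑ i, x i))
      rw [← mul_assoc, ← mul_pow, mul_inv_cancel₀ (ne_of_gt hs), one_pow, one_mul] at h2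
      linarith

/-- The de Klerk–Pasechnik matrix `M_{G,t} = t(I + A_G) - J`
[cite: DeklerkPasechnik2002, (2)] [cite: LaurentVargas2022, §1]. -/
def dkpMatrix (t : ℝ) : Matrix V V ℝ := t • msMatrix G - onesMatrix

/-- `xᵀ M_{G,t} x = t · xᵀ(I + A_G)x - (∑ xᵢ)²`. [folklore] -/
@[folklore] private theorem form_dkpMatrix (t : ℝ) (x : V → ℝ) :
    x ⬝ᵥ dkpMatrix G t *ᵥ x = t * msForm G x - (∑ i, x i) ^ 2 := by
  rw [dkpMatrix, Matrix.sub_mulVec, dotProduct_sub, Matrix.smul_mulVec, dotProduct_smul,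
    form_onesMatrix, smul_eq_mul, msForm]

/-- **de Klerk–Pasechnik's copositive formulation of the stability number**
[cite: DeklerkPasechnik2002, (2)] [cite: Gvozdenovic2008, Cor 4.2.9]
[cite: LaurentVargas2022, §1]: `t(I + A_G) - J` is copositive iff `t ≥ α(G)`. -/
theorem isCopositive_dkpMatrix_iff [Nonempty V] (t : ℝ) :
    IsCopositive (dkpMatrix G t) ↔ (G.indepNum : ℝ) ≤ t := by
  have hα : (0 : ℝ) < G.indepNum := by exact_mod_cast indepNum_pos G
  have key : IsCopositive (dkpMatrix G t) ↔ ∀ x ∈ stdSimplex ℝ V, 1 ≤ t * msForm G x := by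
    have h := isCopositive_sub_smul_ones_iff (t • msMatrix G) 1
    rw [one_smul] at h
    rw [dkpMatrix, h]
    refine forall₂_congr fun x _ => ?_
    rw [Matrix.smul_mulVec, dotProduct_smul, smul_eq_mul, msForm]
  rw [key]
  constructor
  · intro h
    obtain ⟨x, hx, hxe⟩ := exists_msForm_eq_inv_indepNum G
    have h1 := h x hx
    rw [hxe, mul_one_div] at h1
    by_contra hlt
    have : t / (G.indepNum : ℝ) < 1 := (div_lt_one hα).2 (lt_of_not_ge hlt)
    linarith
  · intro h x hx
    have h1 := inv_indepNum_le_msForm G x hx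
    have ht : 0 < t := lt_of_lt_of_le hα h
    calc (1 : ℝ) = t * (1 / t) := by rw [mul_one_div, div_self (ne_of_gt ht)]
      _ ≤ t * (1 / (G.indepNum : ℝ)) := by
          gcongr
      _ ≤ t * msForm G x := mul_le_mul_of_nonneg_left h1 ht.le

/-- Hence `α(G) = min {t : t(I + A_G) - J ∈ COP_n}` [cite: DeklerkPasechnik2002, (2)]
[cite: Gvozdenovic2008, Cor 4.2.9 (4.36)]. -/
theorem isLeast_isCopositive_dkpMatrix [Nonempty V] :
    IsLeast {t : ℝ | IsCopositive (dkpMatrix G t)} (G.indepNum : ℝ) :=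
  ⟨(isCopositive_dkpMatrix_iff G _).2 le_rfl, fun _ ht => (isCopositive_dkpMatrix_iff G _).1 ht⟩

/-! ## Parrilo's LP cones `C^{(r)}_n` and the Pólya certificate -/

section Polya

open MvPolynomial

/-- The quadratic form `p_M(x) = xᵀ M x` as a polynomial [cite: LaurentVargas2022, §1 (p_M)]. -/
def quadForm (M : Matrix V V ℝ) : MvPolynomial V ℝ := ∑ i, ∑ j, C (M i j) * X i * X j

omit [DecidableEq V] in
/-- `p_M` evaluates to the quadratic form [cite: LaurentVargas2022, §1 (p_M(x) = xᵀMx)]. -/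
theorem eval_quadForm (M : Matrix V V ℝ) (x : V → ℝ) : eval x (quadForm M) = x ⬝ᵥ M *ᵥ x := by
  simp only [quadForm, map_sum, map_mul, eval_C, eval_X, dotProduct, Matrix.mulVec,
    Finset.mul_sum]
  exact Finset.sum_congr rfl fun i _ => Finset.sum_congr rfl fun j _ => by ring

omit [Fintype V] [DecidableEq V] in
/-- `C a · Xᵢ · Xⱼ` is the monomial `a x^{eᵢ + eⱼ}`. [folklore] -/
@[folklore] private theorem C_mul_X_mul_X (a : ℝ) (i j : V) :
    C a * X i * X j = monomial (Finsupp.single i 1 + Finsupp.single j 1) a := by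
  rw [C_mul_X_eq_monomial, ← pow_one (X j : MvPolynomial V ℝ), X_pow_eq_monomial,
    monomial_mul, mul_one]

omit [DecidableEq V] in
/-- `quadForm M` as a sum of monomials. [folklore] -/
@[folklore] private theorem quadForm_eq (M : Matrix V V ℝ) :
    quadForm M = ∑ i, ∑ j, monomial (Finsupp.single i 1 + Finsupp.single j 1) (M i j) := by
  simp only [quadForm, C_mul_X_mul_X]

omit [DecidableEq V] in
/-- `p_M` is a quadratic form. [folklore] -/
@[folklore] private theorem quadForm_isHomogeneous (M : Matrix V V ℝ) :
    (quadForm M).IsHomogeneous 2 := by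
  rw [quadForm_eq]
  refine IsHomogeneous.sum _ _ _ fun i _ => IsHomogeneous.sum _ _ _ fun j _ => ?_
  exact isHomogeneous_monomial _ (by rw [map_add, Finsupp.degree_single, Finsupp.degree_single])

omit [DecidableEq V] in
/-- `(∑ Xᵢ)^r · p_M` is a form of degree `r + 2`. [folklore] -/
@[folklore] private theorem sumX_pow_mul_quadForm_isHomogeneous (M : Matrix V V ℝ) (r : ℕ) :
    ((∑ i, X i : MvPolynomial V ℝ) ^ r * quadForm M).IsHomogeneous (r + 2) := by
  have hS : (∑ i, X i : MvPolynomial V ℝ).IsHomogeneous 1 :=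
    IsHomogeneous.sum _ _ _ fun i _ => isHomogeneous_X ℝ i
  have := (hS.pow r).mul (quadForm_isHomogeneous M)
  simpa using this

/-- Membership of `M` in Parrilo's cone `C^{(r)}_n`: the polynomial `(∑ᵢ xᵢ)^r · xᵀMx` has
nonnegative coefficients [cite: LaurentVargas2022, §1 (C^{(r)}_n)]
[cite: DeklerkPasechnik2002, §4] [cite: Gvozdenovic2008, §4.2.1]. -/
def InPolyaCone (r : ℕ) (M : Matrix V V ℝ) : Prop :=
  ∀ m : V →₀ ℕ, 0 ≤ coeff m ((∑ i, X i : MvPolynomial V ℝ) ^ r * quadForm M)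

omit [Fintype V] in
/-- Polynomials with nonnegative coefficients are closed under multiplication. [folklore] -/
@[folklore] private theorem coeff_mul_nonneg {p q : MvPolynomial V ℝ} (hp : ∀ m, 0 ≤ coeff m p)
    (hq : ∀ m, 0 ≤ coeff m q) (m : V →₀ ℕ) : 0 ≤ coeff m (p * q) := by
  rw [coeff_mul]
  exact Finset.sum_nonneg fun x _ => mul_nonneg (hp _) (hq _)

omit [DecidableEq V] in
/-- `(∑ Xᵢ)^k` has nonnegative (multinomial) coefficients. [folklore] -/
@[folklore] private theorem coeff_sumX_pow_nonneg (k : ℕ) (m : V →₀ ℕ) :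
    0 ≤ coeff m ((∑ i, X i : MvPolynomial V ℝ) ^ k) := by
  rw [coeff_sum_X_pow_of_fintype]; exact Nat.cast_nonneg _

omit [DecidableEq V] in
/-- The cones increase with `r`: `C^{(r)} ⊆ C^{(r')}` for `r ≤ r'`
[cite: DeklerkPasechnik2002, §4] [cite: Gvozdenovic2008, §4.2.1]. -/
theorem InPolyaCone.mono {r r' : ℕ} {M : Matrix V V ℝ} (h : InPolyaCone r M) (hr : r ≤ r') :
    InPolyaCone r' M := by
  classical
  intro m
  obtain ⟨k, rfl⟩ := Nat.exists_eq_add_of_le hr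
  rw [add_comm, pow_add, mul_assoc]
  exact coeff_mul_nonneg (coeff_sumX_pow_nonneg k) h m

omit [DecidableEq V] in
/-- `C^{(r)}_n ⊆ COP_n`: a Pólya certificate proves copositivity
[cite: LaurentVargas2022, §1] [cite: Gvozdenovic2008, §4.2.1]. -/
theorem InPolyaCone.isCopositive {r : ℕ} {M : Matrix V V ℝ} (h : InPolyaCone r M) :
    IsCopositive M := by
  intro x hx
  have h1 := Literature.Algebra.Polynomial.eval_nonneg_of_coeff_nonneg _ h hx
  rw [map_mul, map_pow, map_sum, eval_quadForm] at h1
  simp only [eval_X] at h1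
  rcases (Finset.sum_nonneg fun i (_ : i ∈ univ) => hx i).eq_or_lt with hs | hs
  · rw [eq_zero_of_sum_eq_zero hx hs.symm]; simp
  · exact (mul_nonneg_iff_of_pos_left (pow_pos hs r)).1 h1

/-- The coefficients of `(∑ Xᵢ)²` count ordered pairs: `[x^α](∑Xᵢ)² = #{(i,j) : eᵢ + eⱼ = α}`.
[folklore] -/
@[folklore] private theorem coeff_sumX_sq (α : V →₀ ℕ) :
    coeff α ((∑ i, X i : MvPolynomial V ℝ) ^ 2) =
      ∑ i, ∑ j, if Finsupp.single i 1 + Finsupp.single j 1 = α then (1 : ℝ) else 0 := by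
  rw [sq, Finset.sum_mul_sum, coeff_sum]
  refine Finset.sum_congr rfl fun i _ => ?_
  rw [coeff_sum]
  refine Finset.sum_congr rfl fun j _ => ?_
  rw [← one_mul (X i : MvPolynomial V ℝ), ← C_1, C_mul_X_mul_X, coeff_monomial]

omit [DecidableEq V] in
/-- Coefficient bound for a quadratic form: `|[x^α] p_M| ≤ (max |M_ij|) · |α|!/α!`.
[folklore] -/
@[folklore] private theorem abs_coeff_quadForm_le (M : Matrix V V ℝ) {L : ℝ} (hL0 : 0 ≤ L)
    (hL : ∀ i j, |M i j| ≤ L) (α : V →₀ ℕ) :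
    |coeff α (quadForm M)| ≤ L * (α.multinomial : ℝ) := by
  classical
  have hcoeff : coeff α (quadForm M) =
      ∑ i, ∑ j, if Finsupp.single i 1 + Finsupp.single j 1 = α then M i j else 0 := by
    rw [quadForm_eq, coeff_sum]
    refine Finset.sum_congr rfl fun i _ => ?_
    rw [coeff_sum]
    refine Finset.sum_congr rfl fun j _ => ?_
    rw [coeff_monomial]
  rw [hcoeff]
  calc |∑ i, ∑ j, if Finsupp.single i 1 + Finsupp.single j 1 = α then M i j else 0|
      ≤ ∑ i, |∑ j, if Finsupp.single i 1 + Finsupp.single j 1 = α then M i j else 0| :=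
        Finset.abs_sum_le_sum_abs _ _
    _ ≤ ∑ i, ∑ j, |if Finsupp.single i 1 + Finsupp.single j 1 = α then M i j else 0| :=
        Finset.sum_le_sum fun i _ => Finset.abs_sum_le_sum_abs _ _
    _ ≤ ∑ i, ∑ j, L * (if Finsupp.single i 1 + Finsupp.single j 1 = α then (1 : ℝ) else 0) :=
        Finset.sum_le_sum fun i _ => Finset.sum_le_sum fun j _ => by
          split_ifs
          · simpa using hL i j
          · simp
    _ = L * coeff α ((∑ i, X i : MvPolynomial V ℝ) ^ 2) := by
        rw [coeff_sumX_sq, Finset.mul_sum]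
        simp only [Finset.mul_sum]
    _ ≤ L * (α.multinomial : ℝ) := by
        gcongr
        rw [coeff_sum_X_pow_of_fintype]
        split_ifs <;> simp

omit [DecidableEq V] in
/-- **Strictly copositive matrices have Pólya certificates, with the Powers–Reznick rate**
[cite: DeklerkPasechnik2002, §4] [cite: Gvozdenovic2008, Thm 4.2.1 and §4.2.1
(Int 𝒞_n ⊆ ⋃_r C^{(r)}_n)] via [cite: PowersReznick2001, Thm 1]: if `|M_ij| ≤ L` and
`xᵀMx ≥ λ` on the simplex with `L < λ (r + 2)` (e.g. `λ > 0` and `r > L/λ - 2`), then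
`M ∈ C^{(r)}_n`. -/
theorem inPolyaCone_of_strict (M : Matrix V V ℝ) {L lam : ℝ} (hL : ∀ i j, |M i j| ≤ L)
    (hlam : ∀ x ∈ stdSimplex ℝ V, lam ≤ x ⬝ᵥ M *ᵥ x) {r : ℕ}
    (hr : L < lam * (r + 2)) : InPolyaCone r M := by
  classical
  rcases isEmpty_or_nonempty V with hV | hV
  · intro m
    have : quadForm M = 0 := by simp [quadForm]
    rw [this, mul_zero, coeff_zero]
  obtain ⟨i₀⟩ := hV
  have hL0 : 0 ≤ L := le_trans (abs_nonneg _) (hL i₀ i₀)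
  intro m
  by_cases hm : m.degree = r + 2
  · refine le_of_lt (Literature.Algebra.Polynomial.polya_powersReznick (quadForm M)
      (quadForm_isHomogeneous M) (abs_coeff_quadForm_le M hL0 hL)
      (fun x hx => by rw [eval_quadForm]; exact hlam x hx) ?_ m hm)
    rw [Nat.choose_self]; push_cast; linarith
  · rw [(sumX_pow_mul_quadForm_isHomogeneous M r).coeff_eq_zero hm]

end Polya

/-! ### The coefficient criterion for `C^{(r)}_n` -/

section Criterion

open MvPolynomial

omit [DecidableEq V] in
/-- `n (n - 1)` as a real number equals the falling factorial `n^(2)`. [folklore] -/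
@[folklore] private theorem cast_descFactorial_two (n : ℕ) :
    ((n.descFactorial 2 : ℕ) : ℝ) = (n : ℝ) * ((n : ℝ) - 1) := by
  rw [Nat.descFactorial_succ, Nat.descFactorial_succ, Nat.descFactorial_zero, mul_one,
    Nat.sub_zero]
  rcases Nat.eq_zero_or_pos n with rfl | hn
  · simp
  · rw [Nat.cast_mul, Nat.cast_sub hn, Nat.cast_one]; ring

/-- The falling factorials `∏ₖ mₖ^{(αₖ)}` for `α = eᵢ + eⱼ`. [folklore] -/
@[folklore] private theorem prod_descFactorial_single_add_single (m : V →₀ ℕ) (i j : V) :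
    (∏ k, (((m k).descFactorial ((Finsupp.single i 1 + Finsupp.single j 1 : V →₀ ℕ) k) : ℕ) :
      ℝ)) = if i = j then (m i : ℝ) * ((m i : ℝ) - 1) else (m i : ℝ) * (m j : ℝ) := by
  split_ifs with hij
  · subst hij
    rw [← Finsupp.single_add, Finset.prod_eq_single i (fun k _ hk => by
      rw [Finsupp.single_eq_of_ne hk, Nat.descFactorial_zero, Nat.cast_one]) (fun h =>
      absurd (Finset.mem_univ i) h), Finsupp.single_eq_same]
    exact cast_descFactorial_two (m i)
  · have hsplit : ∀ k, (m k).descFactorial ((Finsupp.single i 1 + Finsupp.single j 1 : V →₀ ℕ) k) =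
        (m k).descFactorial (Finsupp.single i 1 k) * (m k).descFactorial (Finsupp.single j 1 k) := by
      intro k
      rw [Finsupp.add_apply]
      by_cases hki : k = i
      · subst hki
        rw [Finsupp.single_eq_of_ne hij, add_zero, Nat.descFactorial_zero, mul_one]
      · rw [Finsupp.single_eq_of_ne hki, zero_add, Nat.descFactorial_zero, one_mul]
    simp_rw [hsplit, Nat.cast_mul, Finset.prod_mul_distrib]
    have hone : ∀ a : V, (∏ k, (((m k).descFactorial (Finsupp.single a 1 k) : ℕ) : ℝ)) = m a := by
      intro a
      rw [Finset.prod_eq_single a (fun k _ hk => by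
        rw [Finsupp.single_eq_of_ne hk, Nat.descFactorial_zero, Nat.cast_one]) (fun h =>
        absurd (Finset.mem_univ a) h), Finsupp.single_eq_same, Nat.descFactorial_one]
    rw [hone, hone]

/-- **Coefficient formula for `(∑ xᵢ)^r · xᵀMx`** [cite: Gvozdenovic2008, (4.35) (proof of
Prop 4.2.6)] [cite: DeklerkPasechnik2002, §4]: for `|m| = r + 2`,
`(∏ₖ mₖ!) · [x^m]((∑ xᵢ)^r · xᵀMx) = r! · (mᵀ M m - mᵀ diag M)`. -/
theorem prod_factorial_mul_coeff (M : Matrix V V ℝ) (r : ℕ) (m : V →₀ ℕ)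
    (hm : m.degree = r + 2) :
    (∏ k, ((m k).factorial : ℝ)) * coeff m ((∑ i, X i : MvPolynomial V ℝ) ^ r * quadForm M) =
      (r.factorial : ℝ) * ((∑ i, ∑ j, M i j * m i * m j) - ∑ i, M i i * m i) := by
  classical
  have hterm : ∀ i j : V, (∏ k, ((m k).factorial : ℝ)) *
      coeff m ((∑ i, X i : MvPolynomial V ℝ) ^ r *
        monomial (Finsupp.single i 1 + Finsupp.single j 1) (M i j)) =
      r.factorial * (M i j * (if i = j then (m i : ℝ) * ((m i : ℝ) - 1) else (m i : ℝ) * m j)) := by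
    intro i j
    have hhom : (monomial (Finsupp.single i 1 + Finsupp.single j 1) (M i j) :
        MvPolynomial V ℝ).IsHomogeneous 2 :=
      isHomogeneous_monomial _ (by rw [map_add, Finsupp.degree_single, Finsupp.degree_single])
    rw [Literature.Algebra.Polynomial.prod_factorial_mul_coeff_sum_X_pow_mul _ hhom r m hm]
    congr 1
    by_cases hij0 : M i j = 0
    · rw [hij0, monomial_zero, support_zero, Finset.sum_empty, zero_mul]
    · rw [support_monomial, if_neg hij0, Finset.sum_singleton, coeff_monomial, if_pos rfl,
        prod_descFactorial_single_add_single]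
  rw [quadForm_eq, Finset.mul_sum, coeff_sum, Finset.mul_sum]
  have hstep : ∀ i, (∏ k, ((m k).factorial : ℝ)) *
      coeff m (∑ j, (∑ i, X i : MvPolynomial V ℝ) ^ r *
        monomial (Finsupp.single i 1 + Finsupp.single j 1) (M i j)) =
      r.factorial * ∑ j, (M i j * m i * m j - if i = j then M i j * m i else 0) := by
    intro i
    rw [coeff_sum, Finset.mul_sum, Finset.mul_sum]
    refine Finset.sum_congr rfl fun j _ => ?_
    rw [hterm]
    congr 1
    split_ifs with h
    · subst h; ring
    · ring
  simp_rw [Finset.mul_sum, hstep]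
  rw [← Finset.mul_sum]
  congr 1
  simp only [Finset.sum_sub_distrib, Finset.sum_ite_eq, Finset.mem_univ, if_true]

omit [DecidableEq V] in
/-- **The LP characterisation of `C^{(r)}_n`** [cite: DeklerkPasechnik2002, §4]
[cite: Gvozdenovic2008, (4.35)] [cite: BomzeEtAl2000, §2]: `M ∈ C^{(r)}_n` iff
`mᵀ M m ≥ mᵀ diag(M)` for every `m ∈ ℕⁿ` with `|m| = r + 2`. -/
theorem inPolyaCone_iff (M : Matrix V V ℝ) (r : ℕ) :
    InPolyaCone r M ↔ ∀ m : V →₀ ℕ, m.degree = r + 2 →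
      ∑ i, M i i * m i ≤ ∑ i, ∑ j, M i j * m i * m j := by
  classical
  have hr : (0 : ℝ) < r.factorial := by exact_mod_cast Nat.factorial_pos _
  have hpos : ∀ m : V →₀ ℕ, 0 < ∏ k, ((m k).factorial : ℝ) := fun m =>
    Finset.prod_pos fun k _ => by exact_mod_cast Nat.factorial_pos _
  constructor
  · intro h m hm
    have h2 : 0 ≤ (r.factorial : ℝ) * ((∑ i, ∑ j, M i j * m i * m j) - ∑ i, M i i * m i) := by
      rw [← prod_factorial_mul_coeff M r m hm]; exact mul_nonneg (hpos m).le (h m)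
    exact sub_nonneg.1 ((mul_nonneg_iff_of_pos_left hr).1 h2)
  · intro h m
    by_cases hm : m.degree = r + 2
    · have key : 0 ≤ (∏ k, ((m k).factorial : ℝ)) *
          coeff m ((∑ i, X i : MvPolynomial V ℝ) ^ r * quadForm M) := by
        rw [prod_factorial_mul_coeff M r m hm]
        exact mul_nonneg hr.le (sub_nonneg.2 (h m hm))
      exact (mul_nonneg_iff_of_pos_left (hpos m)).1 key
    · rw [(sumX_pow_mul_quadForm_isHomogeneous M r).coeff_eq_zero hm]

end Criterion

/-! ## The de Klerk–Pasechnik LP hierarchy `ζ^{(r)}(G)` -/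

section Hierarchy

open MvPolynomial

/-- The *excess* of an integer vector: `mᵀ(I + A_G)m - |m| = ∑ᵢ mᵢ(mᵢ - 1) + ∑_{i ~ j} mᵢ mⱼ`,
a natural number — the slack variable of the LP conditions of [cite: DeklerkPasechnik2002, §4]
(cf. `βᵀMβ - βᵀdiag M` in [cite: Gvozdenovic2008, (4.35)]). -/
def excess (m : V →₀ ℕ) : ℕ := ∑ i, m i * (m i - 1) + ∑ i, ∑ j, if G.Adj i j then m i * m j else 0

omit [DecidableEq V] in
/-- `|m| = ∑ᵢ mᵢ` over a finite index type. [folklore] -/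
@[folklore] private theorem degree_eq_sum (m : V →₀ ℕ) : m.degree = ∑ i, m i := by
  rw [Finsupp.degree_apply]
  exact Finset.sum_subset (Finset.subset_univ _) fun i _ hi => by simpa using hi

/-- `mᵀ(I + A_G)m = |m| + excess(m)` for `m ∈ ℕⁿ`. [folklore] -/
@[folklore] private theorem msForm_natCast (m : V →₀ ℕ) :
    msForm G (fun i => (m i : ℝ)) = (m.degree : ℝ) + (excess G m : ℝ) := by
  rw [msForm_eq_sum, degree_eq_sum, excess]
  push_cast
  have hsq : ∀ i, ((m i : ℕ) : ℝ) ^ 2 = (m i : ℝ) + (m i : ℝ) * (((m i - 1 : ℕ) : ℕ) : ℝ) := by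
    intro i
    rcases Nat.eq_zero_or_pos (m i) with h | h
    · rw [h]; simp
    · rw [Nat.cast_sub h, Nat.cast_one]; ring
  simp only [hsq, Finset.sum_add_distrib]
  ring

omit [Fintype V] in
/-- Entries of `M_{G,t}`. [folklore] -/
@[folklore] private theorem dkpMatrix_apply (t : ℝ) (i j : V) :
    dkpMatrix G t i j = t * msMatrix G i j - 1 := by
  simp [dkpMatrix, onesMatrix, Matrix.sub_apply, Matrix.smul_apply]

/-- `xᵀ(I + A_G)x` as a double sum over matrix entries. [folklore] -/
@[folklore] private theorem msForm_eq_double_sum (x : V → ℝ) :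
    msForm G x = ∑ i, ∑ j, msMatrix G i j * x i * x j := by
  simp only [msForm, dotProduct, Matrix.mulVec, Finset.mul_sum]
  exact Finset.sum_congr rfl fun i _ => Finset.sum_congr rfl fun j _ => by ring

/-- The LP slack of `M_{G,t}` at `m ∈ ℕⁿ`: `mᵀ M_{G,t} m - mᵀ diag(M_{G,t}) =
t · excess(m) - |m|(|m| - 1)`. [folklore] -/
@[folklore] private theorem dkp_slack (t : ℝ) (m : V →₀ ℕ) :
    (∑ i, ∑ j, dkpMatrix G t i j * (m i : ℝ) * (m j : ℝ)) - ∑ i, dkpMatrix G t i i * (m i : ℝ) =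
      t * (excess G m : ℝ) - ((m.degree : ℝ) ^ 2 - m.degree) := by
  have hdiag : ∀ i, msMatrix G i i = 1 := fun i => by
    rw [msMatrix_apply]; simp
  have hA : ∑ i, ∑ j, dkpMatrix G t i j * (m i : ℝ) * (m j : ℝ) =
      t * msForm G (fun i => (m i : ℝ)) - (∑ i, (m i : ℝ)) ^ 2 := by
    have h1 : ∀ i j, dkpMatrix G t i j * (m i : ℝ) * (m j : ℝ) =
        t * (msMatrix G i j * m i * m j) - (m i : ℝ) * m j := fun i j => by
      rw [dkpMatrix_apply]; ring
    simp only [h1, Finset.sum_sub_distrib, ← Finset.mul_sum, msForm_eq_double_sum, sq,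
      Finset.sum_mul_sum]
  have hB : ∑ i, dkpMatrix G t i i * (m i : ℝ) = (t - 1) * ∑ i, (m i : ℝ) := by
    simp only [dkpMatrix_apply, hdiag, mul_one, Finset.mul_sum]
  have hdeg : ∑ i, (m i : ℝ) = m.degree := by
    rw [degree_eq_sum]; push_cast; rfl
  rw [hA, hB, msForm_natCast, hdeg]
  ring

/-- **The LP conditions defining `ζ^{(r)}(G)`** [cite: DeklerkPasechnik2002, §4]
[cite: LaurentVargas2022, §1 (ζ^{(r)})]: `t(I + A_G) - J ∈ C^{(r)}_n` iff
`(r+2)(r+1) ≤ t · excess(m)` for every `m ∈ ℕⁿ` with `|m| = r + 2`. -/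
theorem inPolyaCone_dkpMatrix_iff (t : ℝ) (r : ℕ) :
    InPolyaCone r (dkpMatrix G t) ↔ ∀ m : V →₀ ℕ, m.degree = r + 2 →
      ((r + 2) * (r + 1) : ℝ) ≤ t * (excess G m : ℝ) := by
  rw [inPolyaCone_iff]
  refine forall₂_congr fun m hm => ?_
  rw [← sub_nonneg, dkp_slack, hm]
  push_cast
  constructor <;> intro h <;> nlinarith

omit [Fintype V] in
/-- The indicator vector of a finite set as an element of `ℕⁿ`. [folklore] -/
@[folklore] private theorem indicator_apply (S : Finset V) (k : V) :
    (∑ i ∈ S, Finsupp.single i 1 : V →₀ ℕ) k = if k ∈ S then 1 else 0 := by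
  rw [Finsupp.finsetSum_apply]
  simp_rw [Finsupp.single_apply]
  rw [Finset.sum_ite_eq']

/-- An independent set carries an integer vector of zero excess. [folklore] -/
@[folklore] private theorem excess_indicator_eq_zero {S : Finset V} (hS : G.IsIndepSet ↑S) :
    excess G (∑ i ∈ S, Finsupp.single i 1) = 0 := by
  rw [excess]
  simp only [indicator_apply]
  refine add_eq_zero_iff_of_nonneg (Nat.zero_le _) (Nat.zero_le _) |>.2 ⟨?_, ?_⟩
  · exact Finset.sum_eq_zero fun i _ => by split_ifs <;> simp
  · refine Finset.sum_eq_zero fun i _ => Finset.sum_eq_zero fun j _ => ?_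
    split_ifs with hij hi hj <;> try simp
    exact absurd hij (hS hi hj (G.ne_of_adj hij))

omit [DecidableEq V] in
/-- Zero excess means: a 0/1 vector supported on an independent set. [folklore] -/
@[folklore] private theorem card_support_of_excess_eq_zero {m : V →₀ ℕ} (h : excess G m = 0) :
    G.IsIndepSet ↑m.support ∧ #m.support = m.degree := by
  rw [excess] at h
  have h12 := (add_eq_zero_iff_of_nonneg (Nat.zero_le _) (Nat.zero_le _)).1 h
  have h1 : ∀ i, m i ≤ 1 := fun i => by
    have := (Finset.sum_eq_zero_iff.1 h12.1) i (Finset.mem_univ i)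
    rcases Nat.mul_eq_zero.1 this with h0 | h0 <;> omega
  have h2 : ∀ i j, G.Adj i j → m i * m j = 0 := fun i j hij => by
    have := (Finset.sum_eq_zero_iff.1 ((Finset.sum_eq_zero_iff.1 h12.2) i (Finset.mem_univ i)))
      j (Finset.mem_univ j)
    simpa [hij] using this
  refine ⟨fun i hi j hj _ hij => ?_, ?_⟩
  · rw [Finset.mem_coe, Finsupp.mem_support_iff] at hi hj
    rcases Nat.mul_eq_zero.1 (h2 i j hij) with h0 | h0
    · exact hi h0
    · exact hj h0
  · rw [Finsupp.degree_apply, Finset.card_eq_sum_ones]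
    refine Finset.sum_congr rfl fun i hi => ?_
    rw [Finsupp.mem_support_iff] at hi
    have := h1 i
    omega

/-- **Feasibility of the LP hierarchy** [cite: DeklerkPasechnik2002, §4]
[cite: LaurentVargas2022, §1 ("ζ^{(r)}(G) < ∞ iff r ≥ α(G) - 1")]: some `t(I + A_G) - J`
lies in `C^{(r)}_n` iff `α(G) ≤ r + 1`. -/
theorem exists_inPolyaCone_dkpMatrix_iff (r : ℕ) :
    (∃ t : ℝ, InPolyaCone r (dkpMatrix G t)) ↔ G.indepNum ≤ r + 1 := by
  constructor
  · rintro ⟨t, ht⟩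
    rw [inPolyaCone_dkpMatrix_iff] at ht
    by_contra hlt
    have hle : r + 2 ≤ G.indepNum := by omega
    obtain ⟨T, hT⟩ := G.exists_isNIndepSet_indepNum
    obtain ⟨S, hST, hS⟩ := Finset.exists_subset_card_eq (hT.card_eq ▸ hle : r + 2 ≤ #T)
    have hSind : G.IsIndepSet ↑S := hT.isIndepSet.mono (by exact_mod_cast hST)
    have hdeg : (∑ i ∈ S, Finsupp.single i 1 : V →₀ ℕ).degree = r + 2 := by
      rw [map_sum]; simp [hS]
    have := ht _ hdeg
    rw [excess_indicator_eq_zero G hSind, Nat.cast_zero, mul_zero] at this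
    have : (0 : ℝ) < (r + 2) * (r + 1) := by positivity
    linarith
  · intro hα
    refine ⟨(r + 2) * (r + 1), ?_⟩
    rw [inPolyaCone_dkpMatrix_iff]
    intro m hm
    have hex : 1 ≤ excess G m := by
      by_contra h0
      have h0' : excess G m = 0 := by omega
      obtain ⟨hind, hcard⟩ := card_support_of_excess_eq_zero G h0'
      have := hind.card_le_indepNum
      omega
    have h1 : (1 : ℝ) ≤ excess G m := by exact_mod_cast hex
    have hc : (0 : ℝ) ≤ ((r : ℝ) + 2) * (r + 1) := by positivity
    have := mul_le_mul_of_nonneg_left h1 hc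
    linarith

/-- **The LP bounds are upper bounds** [cite: DeklerkPasechnik2002, §4]
[cite: LaurentVargas2022, §1 ("α(G) ≤ ϑ^{(r)}(G) ≤ ζ^{(r)}(G)")]: if `t(I + A_G) - J ∈ C^{(r)}_n`
then `α(G) ≤ t`. -/
theorem indepNum_le_of_inPolyaCone_dkpMatrix [Nonempty V] {r : ℕ} {t : ℝ}
    (h : InPolyaCone r (dkpMatrix G t)) : (G.indepNum : ℝ) ≤ t :=
  (isCopositive_dkpMatrix_iff G t).1 h.isCopositive

/-- Feasibility is monotone in `t` (the excess is nonnegative). [folklore] -/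
@[folklore] private theorem inPolyaCone_dkpMatrix_mono {r : ℕ} {t t' : ℝ}
    (h : InPolyaCone r (dkpMatrix G t)) (htt : t ≤ t') : InPolyaCone r (dkpMatrix G t') := by
  rw [inPolyaCone_dkpMatrix_iff] at h ⊢
  intro m hm
  exact le_trans (h m hm) (mul_le_mul_of_nonneg_right htt (Nat.cast_nonneg _))

/-- Motzkin–Straus for integer vectors: `mᵀ(I + A_G)m ≥ |m|²/α(G)`. [folklore] -/
@[folklore] private theorem sq_le_indepNum_mul_msForm [Nonempty V] (m : V →₀ ℕ) :
    (m.degree : ℝ) ^ 2 ≤ G.indepNum * msForm G (fun i => (m i : ℝ)) := by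
  have hα : (0 : ℝ) < G.indepNum := by exact_mod_cast indepNum_pos G
  rcases Nat.eq_zero_or_pos m.degree with h0 | hpos
  · rw [h0, Nat.cast_zero, sq, zero_mul]
    exact mul_nonneg hα.le (by rw [msForm_natCast]; positivity)
  · have hs : (0 : ℝ) < ∑ i, ((m i : ℕ) : ℝ) := by
      rw [← Nat.cast_sum, ← degree_eq_sum]; exact_mod_cast hpos
    have hx0 : ∀ i, (0 : ℝ) ≤ (m i : ℝ) := fun i => Nat.cast_nonneg _
    have h1 := inv_indepNum_le_msForm G _ (inv_smul_mem_stdSimplex hx0 hs)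
    rw [msForm_smul, ← Nat.cast_sum, ← degree_eq_sum] at h1
    rw [div_le_iff₀ hα] at h1
    have hd : (0 : ℝ) < m.degree := by exact_mod_cast hpos
    calc (m.degree : ℝ) ^ 2 = (m.degree : ℝ) ^ 2 * 1 := by ring
      _ ≤ (m.degree : ℝ) ^ 2 * (((m.degree : ℝ))⁻¹ ^ 2 * msForm G (fun i => (m i : ℝ)) *
            G.indepNum) := by gcongr
      _ = G.indepNum * msForm G (fun i => (m i : ℝ)) := by field_simp

/-- **Finite convergence after rounding** [cite: DeklerkPasechnik2002, §4]
[cite: LaurentVargas2022, §1 ("⌊ζ^{(r)}(G)⌋ = α(G) if r ≥ α(G)² - 1")]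
[cite: Gvozdenovic2008, Thm 4.2.10]: for `r + 1 ≥ α(G)²` the value
`t = α(r+1)/(r+2-α) < α(G) + 1` is feasible, i.e. `t(I + A_G) - J ∈ C^{(r)}_n`. -/
theorem exists_inPolyaCone_dkpMatrix_lt [Nonempty V] {r : ℕ} (hr : G.indepNum ^ 2 ≤ r + 1) :
    ∃ t : ℝ, t < G.indepNum + 1 ∧ InPolyaCone r (dkpMatrix G t) := by
  have hα1 : 1 ≤ G.indepNum := indepNum_pos G
  have hαr : G.indepNum ≤ r + 1 := le_trans (by nlinarith) hr
  set a : ℝ := (G.indepNum : ℝ) with ha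
  have ha1 : (1 : ℝ) ≤ a := by rw [ha]; exact_mod_cast hα1
  have har : a ^ 2 ≤ (r : ℝ) + 1 := by rw [ha]; exact_mod_cast hr
  have hgap : 0 < (r : ℝ) + 2 - a := by nlinarith
  refine ⟨a * (r + 1) / (r + 2 - a), ?_, ?_⟩
  · rw [div_lt_iff₀ hgap]; nlinarith
  · rw [inPolyaCone_dkpMatrix_iff]
    intro m hm
    have hms := sq_le_indepNum_mul_msForm G m
    rw [msForm_natCast, hm, ← ha] at hms
    push_cast at hms
    -- `a · excess ≥ (r+2)² - a(r+2) = (r+2)(r+2-a)`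
    have hex : ((r : ℝ) + 2) * (r + 2 - a) ≤ a * (excess G m : ℝ) := by nlinarith
    have ha0 : 0 < a := by linarith
    calc ((r : ℝ) + 2) * (r + 1)
          = (a * (r + 1) / (r + 2 - a)) * (((r : ℝ) + 2) * (r + 2 - a) / a) := by
          field_simp
      _ ≤ (a * (r + 1) / (r + 2 - a)) * (a * (excess G m : ℝ) / a) := by
          gcongr
      _ = a * (r + 1) / (r + 2 - a) * (excess G m : ℝ) := by
          rw [mul_div_assoc, mul_div_cancel_left₀ _ (ne_of_gt ha0)]

/-- Hence, for `r + 1 ≥ α(G)²`, the hierarchy determines `α(G)` after rounding down: there is a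
feasible `t` with `⌊t⌋ = α(G)`, and no feasible `t` lies below `α(G)`
[cite: DeklerkPasechnik2002, §4] [cite: LaurentVargas2022, §1]. -/
theorem exists_inPolyaCone_dkpMatrix_floor_eq [Nonempty V] {r : ℕ} (hr : G.indepNum ^ 2 ≤ r + 1) :
    ∃ t : ℝ, InPolyaCone r (dkpMatrix G t) ∧ ⌊t⌋₊ = G.indepNum := by
  obtain ⟨t, ht, h⟩ := exists_inPolyaCone_dkpMatrix_lt G hr
  have hle := indepNum_le_of_inPolyaCone_dkpMatrix G h
  refine ⟨t, h, (Nat.floor_eq_iff (le_trans (Nat.cast_nonneg _) hle)).2 ⟨hle, ht⟩⟩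

/-- The excess of `s · e_v` is `s(s-1)`. [folklore] -/
@[folklore] private theorem excess_single (v : V) (s : ℕ) :
    excess G (Finsupp.single v s) = s * (s - 1) := by
  rw [excess, Finset.sum_eq_single v (fun k _ hk => by rw [Finsupp.single_eq_of_ne hk, zero_mul])
    (fun h => absurd (Finset.mem_univ v) h), Finsupp.single_eq_same]
  have hadj : ∑ i, ∑ j, (if G.Adj i j then (Finsupp.single v s) i * (Finsupp.single v s) j
      else 0) = 0 := by
    refine Finset.sum_eq_zero fun i _ => Finset.sum_eq_zero fun j _ => ?_
    split_ifs with hij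
    · by_cases hi : i = v
      · subst hi
        rw [Finsupp.single_eq_of_ne (G.ne_of_adj hij).symm, mul_zero]
      · rw [Finsupp.single_eq_of_ne hi, zero_mul]
    · rfl
  rw [hadj, add_zero]

/-- **The LP bound is never exact** (Peña–Vera–Zuluaga) [cite: PenaVeraZuluaga2007, §3]
[cite: LaurentVargas2022, §1 ("if G is not the complete graph then ζ^{(r)}(G) > α(G) for all
r")]: if `G` is not complete and `t(I + A_G) - J ∈ C^{(r)}_n` then `t > α(G)`. (Evaluate the
certificate at the uniform vector of a maximum independent set: the value is `t/α - 1`, while the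
monomial `x_v^{r+2}` alone contributes a positive amount.) -/
theorem indepNum_lt_of_inPolyaCone_dkpMatrix [Nonempty V] (hG : G ≠ ⊤) {r : ℕ} {t : ℝ}
    (h : InPolyaCone r (dkpMatrix G t)) : (G.indepNum : ℝ) < t := by
  classical
  -- `α(G) ≥ 2`, hence `t ≥ 2 > 1`
  have hα2 : 2 ≤ G.indepNum := by
    obtain ⟨v, w, hvw, hadj⟩ : ∃ v w : V, v ≠ w ∧ ¬G.Adj v w := by
      by_contra hcon
      push Not at hcon
      refine hG (SimpleGraph.ext (funext fun v => funext fun w => propext ?_))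
      rw [SimpleGraph.top_adj]
      exact ⟨fun hvw => G.ne_of_adj hvw, fun hvw => hcon v w hvw⟩
    have hind : G.IsIndepSet ↑({v, w} : Finset V) := by
      intro a ha b hb hab
      simp only [Finset.coe_insert, Finset.coe_singleton, Set.mem_insert_iff,
        Set.mem_singleton_iff] at ha hb
      rcases ha with rfl | rfl <;> rcases hb with rfl | rfl
      · exact absurd rfl hab
      · exact hadj
      · exact fun h' => hadj (G.adj_symm h')
      · exact absurd rfl hab
    have := hind.card_le_indepNum
    rwa [Finset.card_pair hvw] at this
  have hαpos : (0 : ℝ) < G.indepNum := by exact_mod_cast indepNum_pos G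
  have hαt : (G.indepNum : ℝ) ≤ t := indepNum_le_of_inPolyaCone_dkpMatrix G h
  have ht1 : 1 < t := by
    have : (2 : ℝ) ≤ G.indepNum := by exact_mod_cast hα2
    linarith
  -- a maximum independent set, a vertex in it, and the uniform vector
  obtain ⟨S, hS⟩ := G.exists_isNIndepSet_indepNum
  have hSne : S.Nonempty := by
    rw [← Finset.card_pos, hS.card_eq]; exact indepNum_pos G
  obtain ⟨v, hv⟩ := hSne
  obtain ⟨hxΔ, hxms⟩ := uniform_mem_and_msForm_eq G hS
  set x : V → ℝ := fun i => if i ∈ S then 1 / (G.indepNum : ℝ) else 0 with hx_def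
  set P : MvPolynomial V ℝ := (∑ i, X i : MvPolynomial V ℝ) ^ r * quadForm (dkpMatrix G t)
    with hP_def
  -- the value of the certificate at `x`
  have hev : eval x P = t * (1 / (G.indepNum : ℝ)) - 1 := by
    rw [hP_def, map_mul, map_pow, map_sum]
    simp only [eval_X]
    rw [hxΔ.2, one_pow, one_mul, eval_quadForm, form_dkpMatrix, hxms, hxΔ.2, one_pow]
  -- the coefficient of `x_v^{r+2}` is positive
  set m₀ : V →₀ ℕ := Finsupp.single v (r + 2) with hm₀_def
  have hm₀ : m₀.degree = r + 2 := Finsupp.degree_single _ _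
  have hcoef : 0 < coeff m₀ P := by
    have hf := prod_factorial_mul_coeff (dkpMatrix G t) r m₀ hm₀
    rw [dkp_slack, hm₀_def, excess_single, ← hm₀_def, hm₀] at hf
    have hprod : 0 < ∏ k, ((m₀ k).factorial : ℝ) :=
      Finset.prod_pos fun k _ => by exact_mod_cast Nat.factorial_pos _
    have hr : (0 : ℝ) < r.factorial := by exact_mod_cast Nat.factorial_pos _
    have hrhs : 0 < (r.factorial : ℝ) *
        (t * (((r + 2) * (r + 2 - 1) : ℕ) : ℝ) - (((r + 2 : ℕ) : ℝ) ^ 2 - ((r + 2 : ℕ) : ℝ))) := by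
      apply mul_pos hr
      have : (((r + 2) * (r + 2 - 1) : ℕ) : ℝ) = ((r : ℝ) + 2) * (r + 1) := by
        rw [show r + 2 - 1 = r + 1 by omega]; push_cast; ring
      rw [this]; push_cast
      have h3 : (0 : ℝ) < ((r : ℝ) + 2) * (r + 1) := by positivity
      have h4 := mul_pos (sub_pos.2 ht1) h3
      nlinarith
    rw [← hf] at hrhs
    exact (mul_pos_iff_of_pos_left hprod).1 hrhs
  -- hence the value at `x ≥ 0` is at least the single term `coeff · x_v^{r+2} > 0`
  have hterm : 0 < coeff m₀ P * ∏ i, x i ^ m₀ i := by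
    apply mul_pos hcoef
    rw [Finset.prod_eq_single v (fun i _ hi => by rw [hm₀_def, Finsupp.single_eq_of_ne hi,
      pow_zero]) (fun h => absurd (Finset.mem_univ v) h)]
    apply pow_pos
    simp only [hx_def, if_pos hv]
    positivity
  have hle : coeff m₀ P * ∏ i, x i ^ m₀ i ≤ eval x P := by
    rw [eval_eq']
    refine Finset.single_le_sum (f := fun d => coeff d P * ∏ i, x i ^ d i) (fun d _ =>
      mul_nonneg (h d) (Finset.prod_nonneg fun i _ => pow_nonneg (hxΔ.1 i) _)) ?_
    exact mem_support_iff.2 (ne_of_gt hcoef)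
  have hpos : 0 < t * (1 / (G.indepNum : ℝ)) - 1 := by rw [← hev]; linarith
  rw [mul_one_div, sub_pos, one_lt_div hαpos] at hpos
  exact hpos

/-- The de Klerk–Pasechnik LP parameter `ζ^{(r)}(G) = inf {t : t(I + A_G) - J ∈ C^{(r)}_n}`
[cite: DeklerkPasechnik2002, §4] [cite: LaurentVargas2022, §1 (ζ^{(r)})]. (It is `0`, the
junk value of `sInf ∅`, when the program is infeasible, i.e. when `r + 1 < α(G)`.) -/
def zeta (r : ℕ) : ℝ := sInf {t : ℝ | InPolyaCone r (dkpMatrix G t)}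

/-- The feasible region of the LP is closed. [folklore] -/
@[folklore] private theorem isClosed_feasible (r : ℕ) :
    IsClosed {t : ℝ | InPolyaCone r (dkpMatrix G t)} := by
  have hset : {t : ℝ | InPolyaCone r (dkpMatrix G t)} =
      ⋂ m : V →₀ ℕ, {t : ℝ | m.degree = r + 2 → ((r + 2) * (r + 1) : ℝ) ≤ t * (excess G m : ℝ)} := by
    ext t
    rw [Set.mem_setOf_eq, inPolyaCone_dkpMatrix_iff, Set.mem_iInter]
    rfl
  rw [hset]
  refine isClosed_iInter fun m => ?_
  by_cases hm : m.degree = r + 2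
  · simp only [hm, true_implies]
    exact isClosed_le continuous_const (continuous_id.mul continuous_const)
  · simp only [hm, false_implies, Set.setOf_true, isClosed_univ]

/-- For a feasible level the infimum `ζ^{(r)}(G)` is attained
[cite: DeklerkPasechnik2002, §4]. -/
theorem inPolyaCone_dkpMatrix_zeta [Nonempty V] {r : ℕ} (hr : G.indepNum ≤ r + 1) :
    InPolyaCone r (dkpMatrix G (zeta G r)) := by
  have hne : {t : ℝ | InPolyaCone r (dkpMatrix G t)}.Nonempty :=
    (exists_inPolyaCone_dkpMatrix_iff G r).2 hr
  have hbdd : BddBelow {t : ℝ | InPolyaCone r (dkpMatrix G t)} :=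
    ⟨G.indepNum, fun t ht => indepNum_le_of_inPolyaCone_dkpMatrix G ht⟩
  exact (isClosed_feasible G r).csInf_mem hne hbdd

/-- `α(G) ≤ ζ^{(r)}(G)` whenever the level is feasible [cite: DeklerkPasechnik2002, §4]
[cite: LaurentVargas2022, §1]. -/
theorem indepNum_le_zeta [Nonempty V] {r : ℕ} (hr : G.indepNum ≤ r + 1) :
    (G.indepNum : ℝ) ≤ zeta G r :=
  indepNum_le_of_inPolyaCone_dkpMatrix G (inPolyaCone_dkpMatrix_zeta G hr)

/-- **`⌊ζ^{(r)}(G)⌋ = α(G)` for `r ≥ α(G)² - 1`** [cite: DeklerkPasechnik2002, §4]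
[cite: LaurentVargas2022, §1] [cite: Gvozdenovic2008, Thm 4.2.10 (the analogous statement
for ϑ^{(r)})]. -/
theorem floor_zeta_eq_indepNum [Nonempty V] {r : ℕ} (hr : G.indepNum ^ 2 ≤ r + 1) :
    ⌊zeta G r⌋₊ = G.indepNum := by
  have hα1 : 1 ≤ G.indepNum := indepNum_pos G
  have hαr : G.indepNum ≤ r + 1 := le_trans (by nlinarith) hr
  obtain ⟨t, ht, h⟩ := exists_inPolyaCone_dkpMatrix_lt G hr
  have hle : zeta G r ≤ t :=
    csInf_le ⟨G.indepNum, fun t ht => indepNum_le_of_inPolyaCone_dkpMatrix G ht⟩ h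
  have hge := indepNum_le_zeta G hαr
  exact (Nat.floor_eq_iff (le_trans (Nat.cast_nonneg _) hge)).2 ⟨hge, by linarith⟩

/-- **`ζ^{(r)}(G) > α(G)` for every feasible `r` unless `G` is complete**
[cite: PenaVeraZuluaga2007, §3] [cite: LaurentVargas2022, §1]. -/
theorem indepNum_lt_zeta [Nonempty V] (hG : G ≠ ⊤) {r : ℕ} (hr : G.indepNum ≤ r + 1) :
    (G.indepNum : ℝ) < zeta G r :=
  indepNum_lt_of_inPolyaCone_dkpMatrix G hG (inPolyaCone_dkpMatrix_zeta G hr)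

end Hierarchy

end Literature.Combinatorics.Optimization.MotzkinStrausCopositive
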